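import Literature.MathematicalPhysics.QuantumFieldTheory.Balaban1983to89.B9LettersZQstarFieldsAtPins

/-!
# `Balaban1983to89.B9LettersZQstarFieldsAtPinsR` — [B9] Theorems 3.12–3.13 (pp. 420–426): the `Q*`- and `Q`-composite letter fields of the rows-20–21
# Z-schemas (`LettersHZ.gQs2 ∕ dgQs`, `Letters313Z(c).gQs2 ∕ gQs1 ∕ q2 ∕ q1`, `Letters313DZ.dgQs`, `Letters313DMZ.dgQsd ∕ pQd`, `Letters313HZ(c).pXQs`) AT THE PINS
# OVER AN ARBITRARY BACKGROUND CARRIER — the carrier-generic twins of dag-n06-w5's `B9LettersZQstarFieldsAtPins` (p634692), for the R-generic certificate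

T. Bałaban, *Propagators for lattice gauge theories in a background field*, Commun. Math. Phys. **99** (1985) 389–434 [`Balaban1985BackgroundPropagators`, "B9"];
[4] = T. Bałaban, *Propagators and renormalization transformations for lattice gauge theories. II*, Commun. Math. Phys. **96** (1984) 223–250 [`Balaban1984PropagatorsII`].

statement-level skeleton of published theorems with citation tags; proofs where landed; nothing here is a claim about the Yang–Mills mass gap

WHY (cell `pub-ymgap`, node N06, bundle F7 rows 20–21, seat dag-n06-l g30, memo `DISPLAY-LEDGER-ROWS2021.md` §2).  The N06 certificate of record (dag-n06-d, ED.77 «UD»,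
`Summits/…/BalabanUVNodesN06AtOpsYNuOfRecordV6EPairUD`) lives on the R-GENERIC carrier `bg9YR (M_N(ℂ)) SU(N) R₁ R₂ x` and still DISPLAYS, among rows 20–21's letters, the whole
`G₀Q*` family — `hZ8`.2∕.3 (`gQs2 gQs1`), `hlettersH12`.gQs2∕.dgQs, `hdgQs`, `hdgQsd`, `hpQd`, `hpXQs` — although it DERIVES the G₀ layer at rate δ12₀ (`g0_layer_of_thm310_coreDir₃US`:
`Thm33G0.e0`, the (3.42)₁ homogeneous majorant `he1G`, `Thm33G0Dir.e1d ∕ h43d`) and holds the `Q*` pin `hQsco12`.  dag-n06-w5's `B9LettersZQstarFieldsAtPins` derives every one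
of these fields from exactly those G₀ letters + the kinematic letter of `Q*` — but at the SU(N) member carrier `bg9Y … x`, reading the contraction of the taxi transporters off
`(bg9Y …).Reg335`.  THIS FILE re-states the seven theorems for an ARBITRARY background carrier `B` with a configuration map `cfg : B.Cfg → CfgY (M_N(ℂ)) x.toKIdx` and the ONE
hypothesis the proofs use, `hUG : ∀ μ z, cfg U μ z ∈ SU(N)` (at the certificate: `mem_of_reg335R hGR x hU`); the pins read `QscoKH ∕ QcoKH x.toKIdx (trBasis N) B cfg (parBY x.toKIdx) U`
(the certificate's `hQsco12 ∕ hQco12` verbatim with `B := bg9YR … x`, `cfg := fun U => U`).  Proofs: w5's carrier-generic cores `hasMaj_Qstar_of_pins ∕ hasMaj_Q_of_pins` + dag-n06-l's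
`B9Thm313WholeQstarFromG0` composition lemmas, VERBATIM otherwise; `hpar_of_mem` (§0) supplies the transporter contraction (the empty-index case included, so no `NeZero N`).
* §0 `hpar_of_mem`; §1 `gQs2_pinsB`, `gQs1_pinsB`; §2 `dgQs_pinsB`, `dgQsd_pinsB`; §3 `pQd_pinsB`, `pXQs_pinsB`; §4 `q_pinsB` — statements = w5's with the carrier generalised.
HONEST SCOPE.  Kinematic∕bookkeeping compositions; the G₀ letters (`he0 ∕ he1 ∕ he1d ∕ h43d ∕ hpX0`), `Facts347` and the row-sum letter are HYPOTHESES; nothing of [B9]'s Theorems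
3.3 ∕ 3.12 ∕ 3.13 is asserted; COUNT-NEUTRAL; N06 NOT discharged; one finite lattice at a time; nothing continuum, nothing about the mass gap ∕ Clay.  NEW file; w5's file untouched.
-/

noncomputable section

namespace Literature.MathematicalPhysics.QuantumFieldTheory.Balaban1983to89.B9LettersZQstarFieldsAtPinsR

open scoped Matrix.Norms.L2Operator
open Node00 B6GlobalChartV1 B6KLevelCensusIndexV1
open B6Geom246MultiLevelTorus (geomT)
open B6Ineq2142KLevelV1 (β lvl)
open B6RandomWalk (HasMajorant)
open B6RandomWalkHom (HasMajorantHom)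
open B7Prop2SpecialUnitary (specialUnitaryUnits specialUnitaryUnits_le_U1)
open B9PinMembersKLevelV1 (MemberY geo9Y bg9Y)
open B9CoReadingCoordsTranspose (TrIdx trBasis)
open B9CoReadingCoords (XBK blkBK)
open B9CoReadingCoordsH (XHK blkHK)
open B9GeoNormsKLevelV1 (geo9K geo9K_dist_nonneg)
open B9GeoLemma21KLevelV1 (geo9Y_dist_triangle geo9Y_dist_comm geo9Y_len_pos geo9K_one_le_L)
open B9Thm34Ext (toB6)
open B9SectDSup (weightNorm)
open B11SectG (HasMaj BlockNorm RowSum)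
open B9Thm312Whole (Ops GeoOK cNorm)
open B9Thm312WholeClasses (cNormR)
open B9RWSums343Holder (HolderProbes)
open B9RWSums343to347Whole (Facts347)
open Node00.OpsYSectDCoords (QscoKH QcoKH)
open B9QstarLettersAtPins (hasMaj_Qstar_of_pins)
open B9QLettersAtPins (hasMaj_Q_of_pins)
open B9Thm313WholeQstarFromG0 (gQs2_of_e0 dgQs_of_e1 gQs1_of_e0 pQ_of_h43 pXQs_of_pX0)

variable {d ℓ : ℕ} {hd : 1 ≤ d + 1} {hL : Odd (ℓ + 1) ∧ 1 < ℓ + 1} {b₀ b₁ : ℝ} {Mstar : ℕ} {N : ℕ}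
variable [∀ x : MemberY d ℓ hd hL b₀ b₁ Mstar, Fintype (geo9Y x).Site]

/-! ## §0 SU(N)-valued configurations have contracting taxi transporters -/

omit [∀ x : MemberY d ℓ hd hL b₀ b₁ Mstar, Fintype (geo9Y x).Site] in
/-- An `SU(N)`-valued configuration of a member has taxi transporters `parBY` that are norm contractions together with their inverses (`Node00.parBY_mem` +
`SU(N) ≤ U1`; the empty index type is trivial). [cite: Balaban1985BackgroundPropagators, (3.35) p.396 («U has values in G»), (3.40) p.397 (U(Γ))] -/
theorem hpar_of_mem (x : MemberY d ℓ hd hL b₀ b₁ Mstar) {U : CfgY (Matrix (Fin N) (Fin N) ℂ) x.toKIdx} (hUG : ∀ μ z, U μ z ∈ specialUnitaryUnits (Fin N)) :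
    ∀ s s', ‖(parBY x.toKIdx U s s' : Matrix (Fin N) (Fin N) ℂ)‖ ≤ 1 ∧ ‖(((parBY x.toKIdx U s s')⁻¹ : (Matrix (Fin N) (Fin N) ℂ)ˣ) : Matrix (Fin N) (Fin N) ℂ)‖ ≤ 1 := by
  intro s s'
  rcases isEmpty_or_nonempty (Fin N) with hN | hN
  · have h0 : ∀ A : Matrix (Fin N) (Fin N) ℂ, ‖A‖ ≤ 1 := fun A => by rw [Subsingleton.elim A 0, norm_zero]; exact zero_le_one
    exact ⟨h0 _, h0 _⟩
  · exact specialUnitaryUnits_le_U1 (parBY_mem x.toKIdx (G := specialUnitaryUnits (Fin N)) hUG s s')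

/-! ## §1 Zeroth order: `G₀Q*` into `𝔠⁽²⁾` and, after one transfer, into `𝔠⁽¹⁾` -/

/-- ★★ **`G₀Q*` OUT OF THE WEIGHTED AVERAGING CLASS `Z_{n⁻¹}` INTO `𝔠⁽²⁾` AT THE PINS** — the field `LettersHZ.gQs2` = `Letters313Z.gQs2` =
`Letters313Zc.gQs2` of the rows-20–21 schemas, every member, every SU(N)-valued `U` of any carrier: from the (3.42)₀ letter of `G₀` (`he0`, the G₀ layer's
`Thm33G0.e0` — HYPOTHESIS), dag-n06-w5's carrier-generic `Q*`-letter `hasMaj_Qstar_of_pins` at rate `δ_Q` and dag-n06-l's `gQs2_of_e0`; any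
`B₃ ≥ B₀·e^{δ_Q(ℓ+4)}·c`, rates `0 ≤ δ₃ ≤ δ₀`, `δ₃ + σ ≤ δ_Q`, `0 ≤ δ_Q`.
[cite: Balaban1985BackgroundPropagators, (3.126) p.420 + (3.153) p.426 + (3.42) p.397 + (3.110) p.417 + (3.40) p.397; Balaban1984PropagatorsII, (2.52)–(2.56) pp.232–233 + Lemma 2.1 (2.61) p.234] -/
theorem gQs2_pinsB (x : MemberY d ℓ hd hL b₀ b₁ Mstar) {bI : FBondY x.toKIdx → IBondY x.toKIdx}
    (hβ1 : ∀ f : FBondY x.toKIdx, (geomT x.D).dist (β x.hN x.D x.hk (bI f)) (blkV1 x.hN x.D f) ≤ 1)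
    {Y W : Type} [Fintype Y] [Fintype W]
    {B : B9.Backgrounds} {cfg : B.Cfg → CfgY (Matrix (Fin N) (Fin N) ℂ) x.toKIdx}
    {𝔬 : Ops (geo9Y x) B (XBK (TrIdx N) x.toKIdx) Y (XHK (TrIdx N) x.toKIdx) W}
    {H : Prop} {B₀ δ₀ σ c δ₃ δQ B₃ : ℝ}
    {U : B.Cfg} (hUG : ∀ μ z, cfg U μ z ∈ specialUnitaryUnits (Fin N))
    (hrow : RowSum (toB6 (geo9Y x) 1 H) σ c) (hc : 0 ≤ c) (hB₀ : 0 ≤ B₀)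
    (hδQ : 0 ≤ δQ) (hδ₃ : 0 ≤ δ₃) (hδ₃0 : δ₃ ≤ δ₀) (hδ₃Q : δ₃ + σ ≤ δQ)
    (hB₃ : B₀ * Real.exp (δQ * ((ℓ : ℝ) + 4)) * c ≤ B₃)
    (hblk : 𝔬.blk = blkBK x.toKIdx bI) (hblkZ : 𝔬.blkZ = blkHK x.toKIdx)
    (hQs : 𝔬.Qstar U = QscoKH x.toKIdx (trBasis N) B cfg (parBY x.toKIdx) U)
    (he0 : HasMajorant (g := toB6 (geo9Y x) 1 H) 𝔬.blk (𝔬.G0 U)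
      (fun (a b : (geo9Y x).Site) => B₀ * (geo9Y x).len a ^ 2 * Real.exp (-(δ₀ * (geo9Y x).dist a b))))
    (hpl : ∀ y : (geo9Y x).Site, 0 ≤ ((((ℓ + 1 : ℕ) : ℝ) ^ (d + 1)) ^ lvl x.hN x.D x.hk y)⁻¹) :
    HasMaj (weightNorm (BlockNorm.ofBlocks (toB6 (geo9Y x) 1 H) 𝔬.blkZ) (fun y => ((((ℓ + 1 : ℕ) : ℝ) ^ (d + 1)) ^ lvl x.hN x.D x.hk y)⁻¹) hpl)
      (cNorm 1 H 𝔬.blk (fun y => (geo9Y_len_pos x y).le) 2) (𝔬.G0 U ∘ₗ 𝔬.Qstar U)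
      (fun a b => B₃ * Real.exp (-(δ₃ * (geo9Y x).dist a b))) := by
  letI : Fintype (geo9K x.toKIdx).Site := (inferInstance : Fintype (geo9Y x).Site)
  have hG : GeoOK (geo9Y x) := ⟨geo9Y_dist_triangle x, geo9Y_dist_comm x, geo9K_dist_nonneg x.toKIdx, geo9Y_len_pos x⟩
  have hqs := hasMaj_Qstar_of_pins x.toKIdx (trBasis N) B cfg (parBY x.toKIdx) 𝔬 hblk hblkZ hQs hβ1 (hpar_of_mem x hUG) hδQ (R₀ := (1 : ℝ)) (H₀ := H)
    (fun y => (geo9Y_len_pos x y).le) hpl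
  exact gQs2_of_e0 hG hrow hB₀ (Real.exp_nonneg _) hc hδ₃ hδ₃0 hδ₃Q hB₃ he0 hqs

/-- ★★ **`G₀Q*` OUT OF `Z_{len·n⁻¹}` INTO `𝔠⁽¹⁾` AT THE PINS (ONE p.-398 TRANSFER)** — the field `Letters313Z.gQs1` = `Letters313Zc.gQs1`, every
member, every SU(N)-valued `U` of any carrier: from `he0` (HYPOTHESIS), the member facts `hF : Facts347 … dF δF α L₀` ([4] (2.60) at exponent `α`, `L ≤ L₀`),
`hasMaj_Qstar_of_pins` and dag-n06-l's `gQs1_of_e0`; any `B₃ ≥ B₀·e^{δ_Q(ℓ+4)}·c·L₀`, rates `0 ≤ δ₁ ≤ δ₀`, `δ₁ + σ ≤ δ_Q`, `δ₃ ≤ δ₁ − α·δF`.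
[cite: Balaban1985BackgroundPropagators, (3.153) p.426 + (3.42) p.397 + p.398 (remark after (3.47)) + (3.110) p.417; Balaban1984PropagatorsII, (2.52)–(2.56) pp.232–233 + Lemma 2.1 (2.60)–(2.61) p.234] -/
theorem gQs1_pinsB (x : MemberY d ℓ hd hL b₀ b₁ Mstar) {bI : FBondY x.toKIdx → IBondY x.toKIdx}
    (hβ1 : ∀ f : FBondY x.toKIdx, (geomT x.D).dist (β x.hN x.D x.hk (bI f)) (blkV1 x.hN x.D f) ≤ 1)
    {Y W : Type} [Fintype Y] [Fintype W]
    {B : B9.Backgrounds} {cfg : B.Cfg → CfgY (Matrix (Fin N) (Fin N) ℂ) x.toKIdx}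
    {𝔬 : Ops (geo9Y x) B (XBK (TrIdx N) x.toKIdx) Y (XHK (TrIdx N) x.toKIdx) W}
    {H : Prop} {dF : ℕ} {δF α L₀ : ℝ} (hF : Facts347 (geo9Y x) 1 H dF δF α L₀)
    {B₀ δ₀ σ c δ₁ δ₃ δQ B₃ : ℝ}
    {U : B.Cfg} (hUG : ∀ μ z, cfg U μ z ∈ specialUnitaryUnits (Fin N))
    (hrow : RowSum (toB6 (geo9Y x) 1 H) σ c) (hc : 0 ≤ c) (hB₀ : 0 ≤ B₀)
    (hδQ : 0 ≤ δQ) (hδ₁ : 0 ≤ δ₁) (hδ₁0 : δ₁ ≤ δ₀) (hδ₁Q : δ₁ + σ ≤ δQ) (hδ₃ : δ₃ ≤ δ₁ - α * δF)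
    (hB₃ : B₀ * Real.exp (δQ * ((ℓ : ℝ) + 4)) * c * L₀ ≤ B₃)
    (hblk : 𝔬.blk = blkBK x.toKIdx bI) (hblkZ : 𝔬.blkZ = blkHK x.toKIdx)
    (hQs : 𝔬.Qstar U = QscoKH x.toKIdx (trBasis N) B cfg (parBY x.toKIdx) U)
    (he0 : HasMajorant (g := toB6 (geo9Y x) 1 H) 𝔬.blk (𝔬.G0 U)
      (fun (a b : (geo9Y x).Site) => B₀ * (geo9Y x).len a ^ 2 * Real.exp (-(δ₀ * (geo9Y x).dist a b))))
    (hpl : ∀ y : (geo9Y x).Site, 0 ≤ ((((ℓ + 1 : ℕ) : ℝ) ^ (d + 1)) ^ lvl x.hN x.D x.hk y)⁻¹)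
    (hpl' : ∀ y : (geo9Y x).Site, 0 ≤ (geo9Y x).len y * ((((ℓ + 1 : ℕ) : ℝ) ^ (d + 1)) ^ lvl x.hN x.D x.hk y)⁻¹) :
    HasMaj (weightNorm (BlockNorm.ofBlocks (toB6 (geo9Y x) 1 H) 𝔬.blkZ)
        (fun y => (geo9Y x).len y * ((((ℓ + 1 : ℕ) : ℝ) ^ (d + 1)) ^ lvl x.hN x.D x.hk y)⁻¹) hpl')
      (cNorm 1 H 𝔬.blk (fun y => (geo9Y_len_pos x y).le) 1) (𝔬.G0 U ∘ₗ 𝔬.Qstar U)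
      (fun a b => B₃ * Real.exp (-(δ₃ * (geo9Y x).dist a b))) := by
  letI : Fintype (geo9K x.toKIdx).Site := (inferInstance : Fintype (geo9Y x).Site)
  have hG : GeoOK (geo9Y x) := ⟨geo9Y_dist_triangle x, geo9Y_dist_comm x, geo9K_dist_nonneg x.toKIdx, geo9Y_len_pos x⟩
  have hqs := hasMaj_Qstar_of_pins x.toKIdx (trBasis N) B cfg (parBY x.toKIdx) 𝔬 hblk hblkZ hQs hβ1 (hpar_of_mem x hUG) hδQ (R₀ := (1 : ℝ)) (H₀ := H)
    (fun y => (geo9Y_len_pos x y).le) hpl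
  exact gQs1_of_e0 hG hF hrow hpl hpl' hB₀ (Real.exp_nonneg _) hc hδ₁ hδ₁0 hδ₁Q hB₃ hδ₃ he0 hqs

/-! ## §2 First order: `∇_UG₀Q*` and `∇_{U,ν}G₀Q*` -/

/-- ★★ **`∇_UG₀Q*` OUT OF `Z_{n⁻¹}` INTO `𝔠_Y⁽¹⁾` AT THE PINS** — the field `LettersHZ.dgQs` = `Letters313DZ.dgQs`, every member, every SU(N)-valued `U` of any carrier:
from the (3.42)₁ letter of `∇_UG₀` (`he1`, the G₀ layer's `LeftStep.e1` — HYPOTHESIS), `hasMaj_Qstar_of_pins` and dag-n06-l's `dgQs_of_e1`; any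
`B₃ ≥ B₀·e^{δ_Q(ℓ+4)}·c`, rates `0 ≤ δ₃ ≤ δ₀`, `δ₃ + σ ≤ δ_Q`.
[cite: Balaban1985BackgroundPropagators, (3.126) p.420 + (3.153) p.426 + (3.42) p.397 + (3.110) p.417; Balaban1984PropagatorsII, (2.52)–(2.56) pp.232–233 + Lemma 2.1 (2.61) p.234] -/
theorem dgQs_pinsB (x : MemberY d ℓ hd hL b₀ b₁ Mstar) {bI : FBondY x.toKIdx → IBondY x.toKIdx}
    (hβ1 : ∀ f : FBondY x.toKIdx, (geomT x.D).dist (β x.hN x.D x.hk (bI f)) (blkV1 x.hN x.D f) ≤ 1)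
    {Y W : Type} [Fintype Y] [Fintype W]
    {B : B9.Backgrounds} {cfg : B.Cfg → CfgY (Matrix (Fin N) (Fin N) ℂ) x.toKIdx}
    {𝔬 : Ops (geo9Y x) B (XBK (TrIdx N) x.toKIdx) Y (XHK (TrIdx N) x.toKIdx) W}
    {H : Prop} {B₀ δ₀ σ c δ₃ δQ B₃ : ℝ}
    {U : B.Cfg} (hUG : ∀ μ z, cfg U μ z ∈ specialUnitaryUnits (Fin N))
    (hrow : RowSum (toB6 (geo9Y x) 1 H) σ c) (hc : 0 ≤ c) (hB₀ : 0 ≤ B₀)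
    (hδQ : 0 ≤ δQ) (hδ₃ : 0 ≤ δ₃) (hδ₃0 : δ₃ ≤ δ₀) (hδ₃Q : δ₃ + σ ≤ δQ)
    (hB₃ : B₀ * Real.exp (δQ * ((ℓ : ℝ) + 4)) * c ≤ B₃)
    (hblk : 𝔬.blk = blkBK x.toKIdx bI) (hblkZ : 𝔬.blkZ = blkHK x.toKIdx)
    (hQs : 𝔬.Qstar U = QscoKH x.toKIdx (trBasis N) B cfg (parBY x.toKIdx) U)
    (he1 : HasMajorantHom (g := toB6 (geo9Y x) 1 H) 𝔬.blk 𝔬.blkY (𝔬.D U ∘ₗ 𝔬.G0 U)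
      (fun (a b : (geo9Y x).Site) => B₀ * (geo9Y x).len a * Real.exp (-(δ₀ * (geo9Y x).dist a b))))
    (hpl : ∀ y : (geo9Y x).Site, 0 ≤ ((((ℓ + 1 : ℕ) : ℝ) ^ (d + 1)) ^ lvl x.hN x.D x.hk y)⁻¹) :
    HasMaj (weightNorm (BlockNorm.ofBlocks (toB6 (geo9Y x) 1 H) 𝔬.blkZ) (fun y => ((((ℓ + 1 : ℕ) : ℝ) ^ (d + 1)) ^ lvl x.hN x.D x.hk y)⁻¹) hpl)
      (cNorm 1 H 𝔬.blkY (fun y => (geo9Y_len_pos x y).le) 1) (𝔬.D U ∘ₗ 𝔬.G0 U ∘ₗ 𝔬.Qstar U)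
      (fun a b => B₃ * Real.exp (-(δ₃ * (geo9Y x).dist a b))) := by
  letI : Fintype (geo9K x.toKIdx).Site := (inferInstance : Fintype (geo9Y x).Site)
  have hG : GeoOK (geo9Y x) := ⟨geo9Y_dist_triangle x, geo9Y_dist_comm x, geo9K_dist_nonneg x.toKIdx, geo9Y_len_pos x⟩
  have hqs := hasMaj_Qstar_of_pins x.toKIdx (trBasis N) B cfg (parBY x.toKIdx) 𝔬 hblk hblkZ hQs hβ1 (hpar_of_mem x hUG) hδQ (R₀ := (1 : ℝ)) (H₀ := H)
    (fun y => (geo9Y_len_pos x y).le) hpl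
  exact dgQs_of_e1 hG hrow hB₀ (Real.exp_nonneg _) hc hδ₃ hδ₃0 hδ₃Q hB₃ he1 hqs

/-- ★★ **`∇_{U,ν}G₀Q*` OUT OF `Z_{n⁻¹}` INTO `𝔠⁽¹⁾` AT THE PINS, EVERY DIRECTION `ν`** — the field `Letters313DMZ.dgQsd ν`, every member, every
SU(N)-valued `U` of any carrier: from the direction letters of `∇_{U,ν}G₀` (`he1d`, the G₀ layer's `Thm33G0Dir.e1d` — HYPOTHESIS), `hasMaj_Qstar_of_pins` and dag-n06-l's
`dgQs_of_e1` at `E := ∇_{U,ν}`; any `B₃ ≥ B₀·e^{δ_Q(ℓ+4)}·c`, rates `0 ≤ δ₃ ≤ δ₀`, `δ₃ + σ ≤ δ_Q`.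
[cite: Balaban1985BackgroundPropagators, (3.153) p.426 + (3.42) p.397 + (3.110) p.417 + Thm 3.13 p.426; Balaban1984PropagatorsII, (2.52)–(2.56) pp.232–233 + Lemma 2.1 (2.61) p.234] -/
theorem dgQsd_pinsB (x : MemberY d ℓ hd hL b₀ b₁ Mstar) {bI : FBondY x.toKIdx → IBondY x.toKIdx}
    (hβ1 : ∀ f : FBondY x.toKIdx, (geomT x.D).dist (β x.hN x.D x.hk (bI f)) (blkV1 x.hN x.D f) ≤ 1)
    {Y W P : Type} [Fintype Y] [Fintype W]
    {B : B9.Backgrounds} {cfg : B.Cfg → CfgY (Matrix (Fin N) (Fin N) ℂ) x.toKIdx}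
    {𝔬 : Ops (geo9Y x) B (XBK (TrIdx N) x.toKIdx) Y (XHK (TrIdx N) x.toKIdx) W}
    {Dd : B.Cfg → P → Module.End ℝ (XBK (TrIdx N) x.toKIdx → ℝ)}
    {H : Prop} {B₀ δ₀ σ c δ₃ δQ B₃ : ℝ}
    {U : B.Cfg} (hUG : ∀ μ z, cfg U μ z ∈ specialUnitaryUnits (Fin N))
    (hrow : RowSum (toB6 (geo9Y x) 1 H) σ c) (hc : 0 ≤ c) (hB₀ : 0 ≤ B₀)
    (hδQ : 0 ≤ δQ) (hδ₃ : 0 ≤ δ₃) (hδ₃0 : δ₃ ≤ δ₀) (hδ₃Q : δ₃ + σ ≤ δQ)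
    (hB₃ : B₀ * Real.exp (δQ * ((ℓ : ℝ) + 4)) * c ≤ B₃)
    (hblk : 𝔬.blk = blkBK x.toKIdx bI) (hblkZ : 𝔬.blkZ = blkHK x.toKIdx)
    (hQs : 𝔬.Qstar U = QscoKH x.toKIdx (trBasis N) B cfg (parBY x.toKIdx) U)
    (he1d : ∀ ν : P, HasMajorantHom (g := toB6 (geo9Y x) 1 H) 𝔬.blk 𝔬.blk (Dd U ν ∘ₗ 𝔬.G0 U)
      (fun (a b : (geo9Y x).Site) => B₀ * (geo9Y x).len a * Real.exp (-(δ₀ * (geo9Y x).dist a b))))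
    (hpl : ∀ y : (geo9Y x).Site, 0 ≤ ((((ℓ + 1 : ℕ) : ℝ) ^ (d + 1)) ^ lvl x.hN x.D x.hk y)⁻¹) :
    ∀ ν : P, HasMaj (weightNorm (BlockNorm.ofBlocks (toB6 (geo9Y x) 1 H) 𝔬.blkZ) (fun y => ((((ℓ + 1 : ℕ) : ℝ) ^ (d + 1)) ^ lvl x.hN x.D x.hk y)⁻¹) hpl)
      (cNorm 1 H 𝔬.blk (fun y => (geo9Y_len_pos x y).le) 1) (Dd U ν ∘ₗ 𝔬.G0 U ∘ₗ 𝔬.Qstar U)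
      (fun a b => B₃ * Real.exp (-(δ₃ * (geo9Y x).dist a b))) := by
  letI : Fintype (geo9K x.toKIdx).Site := (inferInstance : Fintype (geo9Y x).Site)
  have hG : GeoOK (geo9Y x) := ⟨geo9Y_dist_triangle x, geo9Y_dist_comm x, geo9K_dist_nonneg x.toKIdx, geo9Y_len_pos x⟩
  have hqs := hasMaj_Qstar_of_pins x.toKIdx (trBasis N) B cfg (parBY x.toKIdx) 𝔬 hblk hblkZ hQs hβ1 (hpar_of_mem x hUG) hδQ (R₀ := (1 : ℝ)) (H₀ := H)
    (fun y => (geo9Y_len_pos x y).le) hpl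
  intro ν
  exact dgQs_of_e1 hG hrow hB₀ (Real.exp_nonneg _) hc hδ₃ hδ₃0 hδ₃Q hB₃ (he1d ν) hqs

/-! ## §3 Hölder probes: `Φ^X_β∘∇_{U,ν}G₀Q*` and `Φ^X_β∘G₀Q*` -/

/-- ★★ **`Φ^X_β∘∇_{U,ν}G₀Q*` OUT OF `Z_{n⁻¹}` INTO THE PROBE CLASS `𝔠_P^{(β−1)}` AT THE PINS, EVERY `ν`, EVERY `0 ≤ β < 1`** — the field
`Letters313DMZ.pQd ν β`, every member, every SU(N)-valued `U` of any carrier: from the (3.43)-shape probe letters of `Φ^X_β∘∇_{U,ν}G₀` (`h43d`, the G₀ layer's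
`Thm33G0Dir.h43d` — HYPOTHESIS), `hasMaj_Qstar_of_pins` and dag-n06-l's `pQ_of_h43`; any `Bq β ≥ Bh β·e^{δ_Q(ℓ+4)}·c` (the letter of
`B9LettersHHZWholeAtPins.lettersHHZ_pins`), rates `0 ≤ δ₃ ≤ δ₀`, `δ₃ + σ ≤ δ_Q`.
[cite: Balaban1985BackgroundPropagators, (3.153) p.426 + (3.43) p.398 + (3.110) p.417 + Thm 3.13 p.426; Balaban1984PropagatorsII, (2.52)–(2.56) pp.232–233 + Lemma 2.1 (2.61) p.234] -/
theorem pQd_pinsB (x : MemberY d ℓ hd hL b₀ b₁ Mstar) {bI : FBondY x.toKIdx → IBondY x.toKIdx}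
    (hβ1 : ∀ f : FBondY x.toKIdx, (geomT x.D).dist (β x.hN x.D x.hk (bI f)) (blkV1 x.hN x.D f) ≤ 1)
    {Y W PX PY P : Type} [Fintype Y] [Fintype W] [Fintype PX] [Fintype PY]
    {B : B9.Backgrounds} {cfg : B.Cfg → CfgY (Matrix (Fin N) (Fin N) ℂ) x.toKIdx}
    {𝔬 : Ops (geo9Y x) B (XBK (TrIdx N) x.toKIdx) Y (XHK (TrIdx N) x.toKIdx) W}
    {𝔭 : HolderProbes (geo9Y x) B (XBK (TrIdx N) x.toKIdx) Y PX PY}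
    {Dd : B.Cfg → P → Module.End ℝ (XBK (TrIdx N) x.toKIdx → ℝ)}
    {H : Prop} {Bh Bq : ℝ → ℝ} {δ₀ σ c δ₃ δQ : ℝ}
    {U : B.Cfg} (hUG : ∀ μ z, cfg U μ z ∈ specialUnitaryUnits (Fin N))
    (hrow : RowSum (toB6 (geo9Y x) 1 H) σ c) (hc : 0 ≤ c) (hBh : ∀ β, 0 ≤ β → β < 1 → 0 ≤ Bh β)
    (hδQ : 0 ≤ δQ) (hδ₃ : 0 ≤ δ₃) (hδ₃0 : δ₃ ≤ δ₀) (hδ₃Q : δ₃ + σ ≤ δQ)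
    (hBq : ∀ β, 0 ≤ β → β < 1 → Bh β * Real.exp (δQ * ((ℓ : ℝ) + 4)) * c ≤ Bq β)
    (hblk : 𝔬.blk = blkBK x.toKIdx bI) (hblkZ : 𝔬.blkZ = blkHK x.toKIdx)
    (hQs : 𝔬.Qstar U = QscoKH x.toKIdx (trBasis N) B cfg (parBY x.toKIdx) U)
    (h43d : ∀ (ν : P) (β : ℝ), 0 ≤ β → β < 1 →
      HasMajorantHom (g := toB6 (geo9Y x) 1 H) 𝔬.blk 𝔭.blkPX (𝔭.ΦX U β ∘ₗ (Dd U ν ∘ₗ 𝔬.G0 U))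
        (fun (a b : (geo9Y x).Site) => Bh β * (geo9Y x).len a ^ (1 - β) * Real.exp (-(δ₀ * (geo9Y x).dist a b))))
    (hpl : ∀ y : (geo9Y x).Site, 0 ≤ ((((ℓ + 1 : ℕ) : ℝ) ^ (d + 1)) ^ lvl x.hN x.D x.hk y)⁻¹) :
    ∀ (ν : P) (β : ℝ), 0 ≤ β → β < 1 →
      HasMaj (weightNorm (BlockNorm.ofBlocks (toB6 (geo9Y x) 1 H) 𝔬.blkZ) (fun y => ((((ℓ + 1 : ℕ) : ℝ) ^ (d + 1)) ^ lvl x.hN x.D x.hk y)⁻¹) hpl)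
        (cNormR 1 H 𝔭.blkPX (fun y => (geo9Y_len_pos x y).le) (β - 1)) ((𝔭.ΦX U β ∘ₗ Dd U ν ∘ₗ 𝔬.G0 U) ∘ₗ 𝔬.Qstar U)
        (fun a b => Bq β * Real.exp (-(δ₃ * (geo9Y x).dist a b))) := by
  letI : Fintype (geo9K x.toKIdx).Site := (inferInstance : Fintype (geo9Y x).Site)
  have hG : GeoOK (geo9Y x) := ⟨geo9Y_dist_triangle x, geo9Y_dist_comm x, geo9K_dist_nonneg x.toKIdx, geo9Y_len_pos x⟩
  have hqs := hasMaj_Qstar_of_pins x.toKIdx (trBasis N) B cfg (parBY x.toKIdx) 𝔬 hblk hblkZ hQs hβ1 (hpar_of_mem x hUG) hδQ (R₀ := (1 : ℝ)) (H₀ := H)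
    (fun y => (geo9Y_len_pos x y).le) hpl
  intro ν β' hβ' hβ'1
  exact pQ_of_h43 hG hrow (hBh β' hβ' hβ'1) (Real.exp_nonneg _) hc hδ₃ hδ₃0 hδ₃Q (hBq β' hβ' hβ'1) (h43d ν β' hβ' hβ'1) hqs

/-- ★★ **`Φ^X_β∘G₀Q*` OUT OF `Z_{len·n⁻¹}` INTO `𝔠_P^{(β−1)}` AT THE PINS, EVERY `0 ≤ β < 1` (ONE p.-398 TRANSFER)** — the field
`Letters313HZ.pXQs β` = `Letters313HZc.pXQs β`, every member, every SU(N)-valued `U` of any carrier: from the zeroth-order probe face of `Φ^X_β∘G₀`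
(`hpX0`, the certificate's derived `pX0` face `N06ProbeZeroAtPinsPhys.hX0_of_pins` ∕ the schema `Thm33G0DirX.pX0` — HYPOTHESIS here), the member
facts `hF : Facts347 … dF δF α L₀`, `hasMaj_Qstar_of_pins` and dag-n06-l's `pXQs_of_pX0`; any `Bx β ≥ Bx0 β·e^{δ_Q(ℓ+4)}·c·L₀`, rates `0 ≤ δ₁ ≤ δ₀`,
`δ₁ + σ ≤ δ_Q`, `δ₃ ≤ δ₁ − α·δF`.
[cite: Balaban1985BackgroundPropagators, (3.153) p.426 + (3.43) p.398 + p.398 (remark after (3.47)) + (3.110) p.417; Balaban1984PropagatorsII, (2.52)–(2.56) pp.232–233 + Lemma 2.1 (2.60)–(2.61) p.234] -/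
theorem pXQs_pinsB (x : MemberY d ℓ hd hL b₀ b₁ Mstar) {bI : FBondY x.toKIdx → IBondY x.toKIdx}
    (hβ1 : ∀ f : FBondY x.toKIdx, (geomT x.D).dist (β x.hN x.D x.hk (bI f)) (blkV1 x.hN x.D f) ≤ 1)
    {Y W PX PY : Type} [Fintype Y] [Fintype W] [Fintype PX] [Fintype PY]
    {B : B9.Backgrounds} {cfg : B.Cfg → CfgY (Matrix (Fin N) (Fin N) ℂ) x.toKIdx}
    {𝔬 : Ops (geo9Y x) B (XBK (TrIdx N) x.toKIdx) Y (XHK (TrIdx N) x.toKIdx) W}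
    {𝔭 : HolderProbes (geo9Y x) B (XBK (TrIdx N) x.toKIdx) Y PX PY}
    {H : Prop} {dF : ℕ} {δF α L₀ : ℝ} (hF : Facts347 (geo9Y x) 1 H dF δF α L₀)
    {Bx0 Bx : ℝ → ℝ} {δ₀ σ c δ₁ δ₃ δQ : ℝ}
    {U : B.Cfg} (hUG : ∀ μ z, cfg U μ z ∈ specialUnitaryUnits (Fin N))
    (hrow : RowSum (toB6 (geo9Y x) 1 H) σ c) (hc : 0 ≤ c) (hBx0 : ∀ β, 0 ≤ β → β < 1 → 0 ≤ Bx0 β)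
    (hδQ : 0 ≤ δQ) (hδ₁ : 0 ≤ δ₁) (hδ₁0 : δ₁ ≤ δ₀) (hδ₁Q : δ₁ + σ ≤ δQ) (hδ₃ : δ₃ ≤ δ₁ - α * δF)
    (hBx : ∀ β, 0 ≤ β → β < 1 → Bx0 β * Real.exp (δQ * ((ℓ : ℝ) + 4)) * c * L₀ ≤ Bx β)
    (hblk : 𝔬.blk = blkBK x.toKIdx bI) (hblkZ : 𝔬.blkZ = blkHK x.toKIdx)
    (hQs : 𝔬.Qstar U = QscoKH x.toKIdx (trBasis N) B cfg (parBY x.toKIdx) U)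
    (hpX0 : ∀ β : ℝ, 0 ≤ β → β < 1 →
      HasMaj (cNormR 1 H 𝔬.blk (fun y => (geo9Y_len_pos x y).le) 0) (cNormR 1 H 𝔭.blkPX (fun y => (geo9Y_len_pos x y).le) (β - 2))
        (𝔭.ΦX U β ∘ₗ 𝔬.G0 U) (fun a b => Bx0 β * Real.exp (-(δ₀ * (geo9Y x).dist a b))))
    (hpl : ∀ y : (geo9Y x).Site, 0 ≤ ((((ℓ + 1 : ℕ) : ℝ) ^ (d + 1)) ^ lvl x.hN x.D x.hk y)⁻¹)
    (hpl' : ∀ y : (geo9Y x).Site, 0 ≤ (geo9Y x).len y * ((((ℓ + 1 : ℕ) : ℝ) ^ (d + 1)) ^ lvl x.hN x.D x.hk y)⁻¹) :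
    ∀ β : ℝ, 0 ≤ β → β < 1 →
      HasMaj (weightNorm (BlockNorm.ofBlocks (toB6 (geo9Y x) 1 H) 𝔬.blkZ)
          (fun y => (geo9Y x).len y * ((((ℓ + 1 : ℕ) : ℝ) ^ (d + 1)) ^ lvl x.hN x.D x.hk y)⁻¹) hpl')
        (cNormR 1 H 𝔭.blkPX (fun y => (geo9Y_len_pos x y).le) (β - 1)) ((𝔭.ΦX U β ∘ₗ 𝔬.G0 U) ∘ₗ 𝔬.Qstar U)
        (fun a b => Bx β * Real.exp (-(δ₃ * (geo9Y x).dist a b))) := by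
  letI : Fintype (geo9K x.toKIdx).Site := (inferInstance : Fintype (geo9Y x).Site)
  have hG : GeoOK (geo9Y x) := ⟨geo9Y_dist_triangle x, geo9Y_dist_comm x, geo9K_dist_nonneg x.toKIdx, geo9Y_len_pos x⟩
  have hqs := hasMaj_Qstar_of_pins x.toKIdx (trBasis N) B cfg (parBY x.toKIdx) 𝔬 hblk hblkZ hQs hβ1 (hpar_of_mem x hUG) hδQ (R₀ := (1 : ℝ)) (H₀ := H)
    (fun y => (geo9Y_len_pos x y).le) hpl
  intro β' hβ' hβ'1
  exact pXQs_of_pX0 hG hF hrow hpl hpl' (hBx0 β' hβ' hβ'1) (Real.exp_nonneg _) hc hδ₁ hδ₁0 hδ₁Q (hBx β' hβ' hβ'1) hδ₃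
    (hpX0 β' hβ' hβ'1) hqs

/-! ## §4 The averaging operator `Q` between the sharp classes -/

/-- ★ **`Q(U)` OUT OF `𝔠⁽ᵖ⁾` INTO THE SHARP AVERAGING CLASS `Z⁽ᵖ⁾` AT THE PINS, RE-LETTERED TO THE SCHEMA KERNEL** — the fields
`Letters313Z.q2 ∕ q1` = `Letters313Zc.q2 ∕ q1` (`p = 2, 1`), every member, every SU(N)-valued `U` of any carrier: dag-n06-w5's `B9QLettersAtPins.hasMaj_Q_of_pins` (kernel
`Lᵖ·e^{2ε(ℓ+4)}·e^{−εd}` above the member threshold `p·log L ≤ ε(2L²−1)M`) read through the pins `hblk`, `hblkZ`, `hQ : 𝔬.Q U = QcoKH … U` and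
weakened to `B₃·e^{−δ₃d}` for any `ε > 0` with `δ₃ ≤ ε` and `B₃ ≥ Lᵖ·e^{2ε(ℓ+4)}` (`L = (geo9Y x).L`).
[cite: Balaban1985BackgroundPropagators, (3.110) p.417 + (3.42) p.397 + (3.153) p.426 + Thm 3.13 p.426; Balaban1984PropagatorsI, (1.18) p.20] -/
theorem q_pinsB (x : MemberY d ℓ hd hL b₀ b₁ Mstar) {bI : FBondY x.toKIdx → IBondY x.toKIdx}
    (hβ1 : ∀ f : FBondY x.toKIdx, (geomT x.D).dist (β x.hN x.D x.hk (bI f)) (blkV1 x.hN x.D f) ≤ 1)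
    {Y W : Type} [Fintype Y] [Fintype W]
    {B : B9.Backgrounds} {cfg : B.Cfg → CfgY (Matrix (Fin N) (Fin N) ℂ) x.toKIdx}
    {𝔬 : Ops (geo9Y x) B (XBK (TrIdx N) x.toKIdx) Y (XHK (TrIdx N) x.toKIdx) W}
    {H : Prop} {ε δ₃ B₃ : ℝ}
    {U : B.Cfg} (hUG : ∀ μ z, cfg U μ z ∈ specialUnitaryUnits (Fin N))
    (p : ℕ) (hε : 0 < ε) (hδ₃ε : δ₃ ≤ ε)
    (hM : (p : ℝ) * Real.log (geo9Y x).L ≤ ε * (2 * ((ℓ : ℝ) + 1) ^ 2 - 1) * (geo9Y x).M)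
    (hB₃ : (geo9Y x).L ^ p * Real.exp (2 * ε * ((ℓ : ℝ) + 4)) ≤ B₃)
    (hblk : 𝔬.blk = blkBK x.toKIdx bI) (hblkZ : 𝔬.blkZ = blkHK x.toKIdx)
    (hQ : 𝔬.Q U = QcoKH x.toKIdx (trBasis N) B cfg (parBY x.toKIdx) U) :
    HasMaj (cNorm 1 H 𝔬.blk (fun y => (geo9Y_len_pos x y).le) p) (cNorm 1 H 𝔬.blkZ (fun y => (geo9Y_len_pos x y).le) p) (𝔬.Q U)
      (fun a b => B₃ * Real.exp (-(δ₃ * (geo9Y x).dist a b))) := by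
  letI : Fintype (geo9K x.toKIdx).Site := (inferInstance : Fintype (geo9Y x).Site)
  have hG : GeoOK (geo9Y x) := ⟨geo9Y_dist_triangle x, geo9Y_dist_comm x, geo9K_dist_nonneg x.toKIdx, geo9Y_len_pos x⟩
  have hq := hasMaj_Q_of_pins x.toKIdx (trBasis N) B cfg (parBY x.toKIdx) hG 𝔬 hblk hblkZ hQ hβ1 (hpar_of_mem x hUG) hε p hM (R₀ := (1 : ℝ)) (H₀ := H)
  refine hq.mono fun a b => ?_
  have hd0 : 0 ≤ (geo9Y x).dist a b := geo9K_dist_nonneg x.toKIdx a b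
  have h1 : Real.exp (-(ε * (geo9Y x).dist a b)) ≤ Real.exp (-(δ₃ * (geo9Y x).dist a b)) :=
    Real.exp_le_exp.mpr (neg_le_neg (mul_le_mul_of_nonneg_right hδ₃ε hd0))
  have h0 : 0 ≤ (geo9Y x).L ^ p * Real.exp (2 * ε * ((ℓ : ℝ) + 4)) :=
    mul_nonneg (pow_nonneg (zero_le_one.trans (geo9K_one_le_L x.toKIdx)) p) (Real.exp_nonneg _)
  calc (geo9Y x).L ^ p * Real.exp (2 * ε * ((ℓ : ℝ) + 4)) * Real.exp (-(ε * (geo9Y x).dist a b))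
      ≤ (geo9Y x).L ^ p * Real.exp (2 * ε * ((ℓ : ℝ) + 4)) * Real.exp (-(δ₃ * (geo9Y x).dist a b)) :=
        mul_le_mul_of_nonneg_left h1 h0
    _ ≤ B₃ * Real.exp (-(δ₃ * (geo9Y x).dist a b)) := mul_le_mul_of_nonneg_right hB₃ (Real.exp_nonneg _)

end Literature.MathematicalPhysics.QuantumFieldTheory.Balaban1983to89.B9LettersZQstarFieldsAtPinsR

end
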